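import Mathlib
import Literature.AlgebraicGeometry.Resolution.CobordantGame
import Literature.AlgebraicGeometry.Resolution.CobordantChartCoefficients
import Literature.AlgebraicGeometry.Resolution.CobordantChartPlaneSlice
import Literature.AlgebraicGeometry.Resolution.CobordantTupleGame
import Literature.AlgebraicGeometry.Resolution.FormalCoordinateChange
import Summits.ResolutionOfSingularities.ResolutionOfSingularities.Theorems.WeightedInvariantGlobalizeLocalDropCanonize
import Summits.ResolutionOfSingularities.ResolutionOfSingularities.Theorems.WeightedInvariantGlobalizeLocalDropCylinder
import Summits.ResolutionOfSingularities.ResolutionOfSingularities.Theorems.WeightedInvariantGlobalizeLocalDropRegularGerms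
import Summits.ResolutionOfSingularities.ResolutionOfSingularities.Theorems.WeightedInvariantLocalWeightedDropHornedRankEquiv
import Summits.ResolutionOfSingularities.ResolutionOfSingularities.Theorems.WeightedInvariantLocalWeightedDropTangentConeCut
import Summits.ResolutionOfSingularities.ResolutionOfSingularities.Theorems.WeightedInvariantLocalWeightedDropMultiplicityLift
import Summits.ResolutionOfSingularities.ResolutionOfSingularities.Theorems.WeightedInvariantLocalWeightedDropMonicPointBlowup

/-!
# `WeightedInvariant.LocalWeightedDrop`, line `hasse-ridge-face-selection`: the point blow-up of a monic form WITH A CHOICE OF SLOT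

Crux item stmt-ResolutionOfSingularities-8899 `LocalWeightedDrop` (route `ResolutionOfSingularities/WeightedInvariant`), serving the
door `WeightedConstruction` stmt-ResolutionOfSingularities-0571.  [OURS · L1 W4.3, chain w43, stub worker 2 (gen 2): a variant of stub
worker 3's brick `won_monic_of_pointBlowup` (p467919) for the reduction pieces S2sM / S2iM; NOT a statement of any manuscript.]

`won_monic_of_pointBlowup_slot`: as `won_monic_of_pointBlowup` (every characteristic, dimension, degree), but at each exceptional point
`c' ≠ 0` (inside `γ = 0`) the caller may CHOOSE the live slot `i₀` (`c'_{i₀} ≠ 0`) whose slice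
`S = y^d + Σ_j (s · B_j)|_{x'_{i₀} ↦ 0} y^j` he wins: since the saturated successor is a unit times a coordinate change of the cylinder over
the slice at ANY live slot (`tameSlice`), one slot per point suffices.  This is what a proof driven by the non-normal-crossing count of a
plane curve needs (`PlaneGermNonNCCountRad` (iii) provides the drop at SOME live slot).
-/

set_option linter.dupNamespace false -- mandated namespace of this single-conjunct summit

namespace Summit.ResolutionOfSingularities.ResolutionOfSingularities.Theorems

open Literature.AlgebraicGeometry.Resolution
open Literature.AlgebraicGeometry.Resolution.CobordantGame

open MonicPointBlowup MvPowerSeries in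
/-- THE POINT BLOW-UP OF A MONIC FORM, SLOT CHOSEN BY THE CALLER (every characteristic `p`, every dimension `m + 1`, every degree
`d ≥ 1`).  Let `P = y^d + Σ_{j<d} A_j(x') y^j` with `ord A_j > d - j`.  If for every exceptional point `c' ≠ 0` and the factorisations
`A_j ∘ chart(c') = s^{d-j+1} B_j` there is SOME live slot `i₀` (`c'_{i₀} ≠ 0`) whose slice `S = y^d + Σ_j (s B_j)|_{x'_{i₀} ↦ 0} y^j`
is won whenever singular, then `P` is won (by the point blow-up: successors over `γ ≠ 0` are units, and over `γ = 0` the saturated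
successor is a unit times a coordinate change of the cylinder over the slice at any live slot, `tameSlice`). -/
theorem won_monic_of_pointBlowup_slot (p : ℕ) (hp : p.Prime) (k : Type) [Field k] [CharP k p] (m d : ℕ) (hd : 0 < d)
    (A : Fin d → MvPowerSeries (Fin m) k) (hA : ∀ j : Fin d, ((d - (j : ℕ) : ℕ) : ℕ∞) < (A j).order)
    (hsucc : ∀ (c : Fin m → k), (∃ i, c i ≠ 0) → ∀ B : Fin d → MvPowerSeries (Fin (m + 1)) k,
      (∀ j, MvPowerSeries.subst (CobordantChart.chart (fun _ : Fin m => 1) c) (A j) =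
        MvPowerSeries.X 0 ^ (d - (j : ℕ) + 1) * B j) →
      ∃ i₀ : Fin m, c i₀ ≠ 0 ∧
        (CobordantGame.IsSingular k (MvPowerSeries.X (Fin.last m) ^ d +
          ∑ j : Fin d, MvPowerSeries.rename (Fin.succAboveEmb (Fin.last m))
            (TupleGame.slice i₀ (MvPowerSeries.X 0 * B j)) * MvPowerSeries.X (Fin.last m) ^ (j : ℕ)) →
        CobordantGame.Won k (m + 1) (MvPowerSeries.X (Fin.last m) ^ d +
          ∑ j : Fin d, MvPowerSeries.rename (Fin.succAboveEmb (Fin.last m))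
            (TupleGame.slice i₀ (MvPowerSeries.X 0 * B j)) * MvPowerSeries.X (Fin.last m) ^ (j : ℕ)))) :
    CobordantGame.Won k (m + 1) (MvPowerSeries.X (Fin.last m) ^ d +
      ∑ j : Fin d, MvPowerSeries.rename (Fin.succAboveEmb (Fin.last m)) (A j) * MvPowerSeries.X (Fin.last m) ^ (j : ℕ)) := by
  classical
  set P : MvPowerSeries (Fin (m + 1)) k := X (Fin.last m) ^ d +
    ∑ j : Fin d, rename (Fin.succAboveEmb (Fin.last m)) (A j) * X (Fin.last m) ^ (j : ℕ) with hP
  refine Won.move X (fun _ => 1) (TangentConeCut.isMove_X_one (Nat.succ_pos m)) fun g hg => ?_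
  obtain ⟨pt, a, ⟨l, -, hptl⟩, hfac, hndvd, hsing⟩ := hg
  have hself : subst (X : Fin (m + 1) → MvPowerSeries (Fin (m + 1)) k) P = P := by
    rw [subst_self]; rfl
  rw [hself] at hfac
  -- the factorisations `A_j ∘ chart(c') = s^{d-j+1} B_j`
  set c : Fin m → k := fun i => pt (Fin.castSucc i) with hc
  have hBex : ∀ j : Fin d, ∃ Bj : MvPowerSeries (Fin (m + 1)) k,
      subst (CobordantChart.chart (fun _ : Fin m => 1) c) (A j) = X 0 ^ (d - (j : ℕ) + 1) * Bj := fun j =>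
    exists_eq_X_pow_mul_of_le_order c (A j) _ (Order.add_one_le_of_lt (hA j))
  choose B hB using hBex
  -- the transform and the saturated successor `g₀`
  set γ : k := pt (Fin.last m) with hγ
  set g₀ : MvPowerSeries (Fin (m + 1 + 1)) k := (C γ + X (Fin.last (m + 1))) ^ d +
    X 0 * ∑ j : Fin d, rename (Fin.succAboveEmb (Fin.last (m + 1))) (B j) * (C γ + X (Fin.last (m + 1))) ^ (j : ℕ)
    with hg₀
  have hT : subst (cruxChart k (fun _ : Fin (m + 1) => 1) pt) P = X 0 ^ d * g₀ := by
    rw [hP, transform_monic A pt B hB]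
  have hndvd₀ : ¬ X 0 ∣ g₀ := fun h => by
    have h1 := coeff_top_g₀ (m := m) d γ
      (∑ j : Fin d, rename (Fin.succAboveEmb (Fin.last (m + 1))) (B j) * (C γ + X (Fin.last (m + 1))) ^ (j : ℕ))
    rw [X_dvd_iff.mp h _ (by rw [Finsupp.single_apply, if_neg Fin.last_pos.ne'])] at h1
    exact zero_ne_one h1
  have hfac₀ := hfac
  rw [hT] at hfac
  obtain ⟨-, hgg⟩ := X_pow_mul_eq_X_pow_mul 0 hfac hndvd₀ hndvd
  subst hgg
  -- `γ = 0`: otherwise `g₀(0) = γ^d ≠ 0`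
  have hγ0 : γ = 0 := by
    have h00 := hsing.1
    rw [hg₀, constantCoeff_g₀] at h00
    exact pow_eq_zero_iff (n := d) (by omega) |>.mp h00
  -- the exceptional point is off the vertex and `γ = 0`: some old slot is live
  have hlive : ∃ i, c i ≠ 0 := by
    rcases Fin.eq_castSucc_or_eq_last l with ⟨i, rfl⟩ | rfl
    · exact ⟨i, hptl⟩
    · exact absurd hγ0 hptl
  -- the caller's slot `i₀`
  obtain ⟨i₀, hci₀, hW⟩ := hsucc c hlive B hB
  -- the tame slice at `i₀`
  rw [cruxChart_one_eq_chart] at hfac₀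
  obtain ⟨Φ₂, u, hΦ₂0, hΦ₂det, hu, hgeq⟩ := tameSlice p hp k (m + 1) P (fun _ => 1) pt
    (fun i hi => absurd hi one_ne_zero) a g₀ hfac₀ (Fin.castSucc i₀) hci₀ (by exact hp.not_dvd_one)
  set S : MvPowerSeries (Fin (m + 1)) k := subst (fun j : Fin (m + 1 + 1) => if j = (Fin.castSucc i₀).succ
    then (0 : MvPowerSeries (Fin (m + 1)) k) else X (Fin.predAbove (Fin.castSucc i₀) j)) g₀ with hS
  suffices hWS : Won k (m + 1) S by
    rw [hgeq]
    exact (won_unit_mul_iff hu _).mpr ((won_subst_iff hΦ₂0 hΦ₂det _).mpr (won_cyl (Fin.castSucc i₀).succ hWS))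
  -- the slice is the monic form `y^d + Σ_j (s B_j)| y^j`
  have hSeq : S = X (Fin.last m) ^ d +
      ∑ j : Fin d, rename (Fin.succAboveEmb (Fin.last m)) (TupleGame.slice i₀ (X 0 * B j)) * X (Fin.last m) ^ (j : ℕ) := by
    rw [hS, hg₀, hγ0]
    exact slice_g₀ i₀ B
  by_cases hSs : IsSingular k S
  · rw [hSeq] at hSs ⊢
    exact hW hSs
  · exact (wonBy_zero_of_not_isSingular m.succ_pos hSs).won

end Summit.ResolutionOfSingularities.ResolutionOfSingularities.Theorems
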